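import Literature.IUT.LogThetaLattice.ThetaPilotObjectsFrakSignature
import Literature.IUT.LogVolume.IdealArithmeticDivisors
import HarnessLib

/-!
# [IUTchIII] Proposition 3.7 (v) / Definition 3.8 (i) at the model of record, C: the Θ-pilot object as an IDEAL
# of the ring of integers — `𝔮̲^{j²} = Π_{v ∈ 𝕍^bad} 𝔭_v^{j²·ord_v(q̲_v)} ⊆ 𝒪_F`, `log N(𝔮̲^{j²}) = deĝ_F(P_{Θ,j})`
# (abc-iut cell, layer L6, §F row F10-c; sequel of `ThetaPilotObjectsFrakSignature.lean`)

S. Mochizuki, *Inter-universal Teichmüller theory III*, kurims manuscript (May 2020), §3, Proposition 3.7 (v)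
p. 112 l. 14–22 ("by applying the definition of `(†𝓕⊛_𝔪𝔬𝔡)_j` — i.e., in terms of local fractional ideals … one
obtains an algorithm for constructing … objects of the [global!] categories … from the local fractional ideals
generated by elements of the monoids `Ψ_{𝓕_lgp}(†𝓗𝓣^{Θ±ell}NF)_v` for `v ∈ 𝕍^bad`") and Definition 3.8 (i) p. 112
(the Θ-pilot object, "the object of … `Π_{j∈𝔽_l^⋇} (†𝓕⊛_𝔪𝔬𝔡)_j` … determined by any collection … of generators up
to torsion of the monoids `Ψ^⊥_{𝓕_lgp}(†𝓗𝓣^{Θ±ell}NF)_v`") [claim: Mochizuki2012, status: disputed] (own render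
`paper:url-4b091feeb646` p0112); [IUTchIII] Ex. 3.6 (ii) p. 107 l. 31–34: a local fractional ideal at
`v ∈ 𝕍^non` is "a finitely generated nonzero `𝒪_{K_v}`-submodule of `K_v`", `𝔍_v = 𝒪_{K_v}` for almost all `v`.

WHAT THIS FILE ADDS (over parts A/B, where the Θ-pilot object is the `ℤ`-exponent family
`thetaPilotExponents X ρ j = Σ_{v ∈ 𝕍^bad} j²·ord_v(q̲_v)·[v]` and its model object `thetaPilotFrakModel X ρ j`): the
collection of local fractional ideals GLUED to an honest ideal of the Dedekind domain `𝒪_F` (Mathlib `Ideal`):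
* `idealOfBadExponents X n = Π_{v ∈ 𝕍^bad} 𝔭_v^{n_v}` (nonzero) and its arithmetic divisor
  `ADivisor.ofIdeal (…) = Σ_{v ∈ 𝕍^bad} n_v·v` (`ofIdeal_idealOfBadExponents`, from `ofIdeal_asIdeal_pow`:
  `ofIdeal (𝔭_v^n) = n·v`, via `multiplicity_pow_self_of_prime` and coprimality of distinct maximal ideals);
* **`thetaPilotIdeal X ρ j = 𝔮̲^{j²} := Π_{v ∈ 𝕍^bad} 𝔭_v^{j²·ord_v(q̲_v)}`** (`ρ_v = q̲_v` a `2l`-th root of the Tate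
  parameter), with **`ADivisor.ofIdeal (thetaPilotIdeal X ρ j) = ofFinDivisor (X.thetaPilot j)`** (the divisor
  of the ideal IS abc-iut-c312-3's theta-pilot divisor `P_{Θ,j}`), **`log N(𝔮̲^{j²}) = deĝ_F(P_{Θ,j})`**
  (`log_absNorm_thetaPilotIdeal`, through the cell's `degF_ofIdeal`), `frakDivisor (thetaPilotFrakModel X ρ j) =
  −ofIdeal (𝔮̲^{j²})` (the line bundle `𝒪(−div 𝔮̲^{j²})`, abc-iut-L6-d3's convention) and **[IUTchIII] Prop. 3.9
  (iii) in ideal form: `μ^log` (of the `j`-th component of the Θ-pilot object) `= −log N(𝔮̲^{j²})`**.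
Classical algebraic number theory over the landed typings; nothing here asserts a disputed claim or takes a
side on [IUTchIII] Cor. 3.12; typed ≠ discharged; instantiated ≠ endorsed.
-/

noncomputable section

namespace Literature.IUT.LogThetaLattice

open Literature.IUT.HodgeArakelov Literature.IUT.LogVolume NumberField IsDedekindDomain
open Literature.IUT.LogThetaLattice.GlobalFrobenioidModels
open Literature.NumberTheory.EllipticCurves

/-! ### §4 The Θ-pilot ideals as ideals of `𝒪_F`: norms, divisors and log-volumes -/

section Ideals

variable {F : Type} [Field F] [NumberField F] (X : PilotData F)

/-- The INTEGRAL IDEAL of `𝒪_F` with a nonnegative exponent family supported on the bad places: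
`Π_{v ∈ 𝕍^bad} 𝔭_v^{n_v}` (the "local fractional ideals" of [IUTchIII] Ex. 3.6 (ii) / Prop. 3.7 (v) glued to a
global ideal of the Dedekind domain `𝒪_F`). [claim: Mochizuki2012, status: disputed] -/
def idealOfBadExponents (n : ∀ v ∈ X.S, ℕ) : Ideal (𝓞 F) := ∏ v ∈ X.S.attach, v.1.asIdeal ^ n v.1 v.2

/-- Such an ideal is nonzero. [claim: Mochizuki2012, status: disputed] -/
theorem idealOfBadExponents_ne_bot (n : ∀ v ∈ X.S, ℕ) : idealOfBadExponents X n ≠ ⊥ :=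
  Finset.prod_ne_zero_iff.mpr fun v _ => pow_ne_zero _ v.1.ne_bot

omit [NumberField F] in
/-- The arithmetic divisor of a prime power `𝔭_v^n` is `n·v` (the cell's [GenEll]-side `ADivisor.ofIdeal`,
`Σ_v ord_v(I)·v` of [GenEll] Def. 1.5 (iii), evaluated on `I = 𝔭_v^n`). [cite: MochizukiGenEll2010, Def. 1.5 (iii) p.9] -/
theorem ofIdeal_asIdeal_pow [NumberField F] (v : HeightOneSpectrum (𝓞 F)) (n : ℕ) :
    ADivisor.ofIdeal (v.asIdeal ^ n) = ADivisor.ofFinDivisor F (FinDivisor.of v (n : ℝ)) := by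
  have hne : v.asIdeal ^ n ≠ ⊥ := pow_ne_zero _ v.ne_bot
  ext p
  rcases p with u | w
  · rw [ADivisor.ofIdeal_apply_inl, ADivisor.ofFinDivisor_apply_inl]
  · rw [ADivisor.ofIdeal_apply_inr hne, ADivisor.ofFinDivisor_apply_inr]
    by_cases h : w = v
    · subst h
      rw [multiplicity_pow_self_of_prime w.prime, Finsupp.single_eq_same]
    · rw [Finsupp.single_eq_of_ne h, Nat.cast_eq_zero, multiplicity_eq_zero]
      intro hdvd
      have hwv := (w.irreducible.dvd_irreducible_iff_associated v.irreducible).mp (w.prime.dvd_of_dvd_pow hdvd)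
      rw [associated_iff_eq] at hwv
      exact h (HeightOneSpectrum.ext hwv)

/-- The arithmetic divisor of `Π_{v ∈ 𝕍^bad} 𝔭_v^{n_v}` is `Σ_{v ∈ 𝕍^bad} n_v·v`. [claim: Mochizuki2012, status: disputed] -/
theorem ofIdeal_idealOfBadExponents (n : ∀ v ∈ X.S, ℕ) :
    ADivisor.ofIdeal (idealOfBadExponents X n) =
      ADivisor.ofFinDivisor F (∑ v ∈ X.S.attach, FinDivisor.of v.1 (n v.1 v.2 : ℝ)) := by
  classical
  unfold idealOfBadExponents
  induction X.S.attach using Finset.induction_on with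
  | empty => rw [Finset.prod_empty, Finset.sum_empty, map_zero, Ideal.one_eq_top, ADivisor.ofIdeal_top]
  | insert a s ha ih =>
    rw [Finset.prod_insert ha, Finset.sum_insert ha, map_add,
      ADivisor.ofIdeal_mul (pow_ne_zero _ a.1.ne_bot)
        (Finset.prod_ne_zero_iff.mpr fun v _ => pow_ne_zero _ v.1.ne_bot),
      ih, ofIdeal_asIdeal_pow]

variable (τ : ∀ v ∈ X.S, (v.adicCompletion F)ˣ)
  (hτ : ∀ v (hv : v ∈ X.S), ‖(τ v hv : v.adicCompletion F)‖ < 1 ∧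
    tateJ (τ v hv : v.adicCompletion F) = (X.jE : v.adicCompletion F))
  (ρ : ∀ v ∈ X.S, (v.adicCompletion F)ˣ) (hρ : ∀ v (hv : v ∈ X.S), ρ v hv ^ (2 * X.l) = τ v hv)

/-- **The Θ-pilot ideal `𝔮̲^{j²} := Π_{v ∈ 𝕍^bad} 𝔭_v^{j²·ord_v(q̲_v)} ⊆ 𝒪_F`** — the `j`-th component of the Θ-pilot object
of [IUTchIII] Def. 3.8 (i) in its `Π_j (†𝓕⊛_𝔪𝔬𝔡)_j`-incarnation, AS AN IDEAL of the ring of integers.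
[claim: Mochizuki2012, status: disputed] -/
def thetaPilotIdeal (i : Fin X.lstar) : Ideal (𝓞 F) :=
  idealOfBadExponents X fun v hv => labelNat i ^ 2 * (CompletionModel.ordv F v (ρ v hv)).toNat

/-- The Θ-pilot ideal is nonzero. [claim: Mochizuki2012, status: disputed] -/
theorem thetaPilotIdeal_ne_bot (i : Fin X.lstar) : thetaPilotIdeal X ρ i ≠ ⊥ :=
  idealOfBadExponents_ne_bot X _

include hτ hρ in
/-- `ord_v(q̲_v) ≥ 0` (indeed `> 0`): the integer exponent agrees with its truncation to `ℕ`.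
[cite: DupuyHilado2025, §3.3] -/
theorem toNat_ordv_root (v : HeightOneSpectrum (𝓞 F)) (hv : v ∈ X.S) :
    ((CompletionModel.ordv F v (ρ v hv)).toNat : ℤ) = CompletionModel.ordv F v (ρ v hv) := by
  refine Int.toNat_of_nonneg ?_
  have h2l : (0 : ℤ) < (2 * X.l : ℕ) := by exact_mod_cast twoL_pos X
  have hq : (0 : ℤ) < (2 * X.l : ℕ) * CompletionModel.ordv F v (ρ v hv) := by
    rw [ordv_root X τ hτ ρ hρ v hv]
    exact X.ordq_pos hv
  exact (pos_of_mul_pos_right hq h2l.le).le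

include hτ hρ in
/-- **The arithmetic divisor of the Θ-pilot ideal `𝔮̲^{j²}` is abc-iut-c312-3's theta-pilot divisor `P_{Θ,j}`**
(extended by zero at the archimedean places). [claim: Mochizuki2012, status: disputed] -/
theorem ofIdeal_thetaPilotIdeal (i : Fin X.lstar) :
    ADivisor.ofIdeal (thetaPilotIdeal X ρ i) = ADivisor.ofFinDivisor F (X.thetaPilot i) := by
  rw [thetaPilotIdeal, ofIdeal_idealOfBadExponents, ← realifyExponents_thetaPilotExponents X τ hτ ρ hρ]
  congr 1
  unfold thetaPilotExponents
  rw [map_sum (realifyExponents (F := F))]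
  refine Finset.sum_congr rfl fun v _ => ?_
  rw [realifyExponents_single]
  congr 1
  have h : (((CompletionModel.ordv F v.1 (ρ v.1 v.2)).toNat : ℕ) : ℝ) =
      ((CompletionModel.ordv F v.1 (ρ v.1 v.2) : ℤ) : ℝ) := by
    exact_mod_cast toNat_ordv_root X τ hτ ρ hρ v.1 v.2
  simp only [Nat.cast_mul, Nat.cast_pow, Int.cast_mul, Int.cast_pow, Int.cast_natCast, h]

include hτ hρ in
/-- **`log N(𝔮̲^{j²}) = deĝ_F(P_{Θ,j})`**: the log of the absolute norm of the Θ-pilot ideal is the degree of the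
theta-pilot divisor. [claim: Mochizuki2012, status: disputed] -/
theorem log_absNorm_thetaPilotIdeal (i : Fin X.lstar) :
    Real.log (Ideal.absNorm (thetaPilotIdeal X ρ i)) = FinDivisor.deg F (X.thetaPilot i) := by
  rw [← degF_ofIdeal F (thetaPilotIdeal_ne_bot X ρ i), ofIdeal_thetaPilotIdeal X τ hτ ρ hρ,
    degF_ofFinDivisor]

include hτ hρ in
/-- The arithmetic divisor "determined by" the Θ-pilot `𝔪𝔬𝔡`-object (abc-iut-L6-d3) is MINUS the divisor of
the ideal `𝔮̲^{j²}`: the line bundle `𝒪(−div 𝔮̲^{j²})`. [claim: Mochizuki2012, status: disputed] -/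
theorem frakDivisor_thetaPilotFrakModel_eq_neg_ofIdeal (i : Fin X.lstar) :
    frakDivisor (thetaPilotFrakModel X ρ i) = -ADivisor.ofIdeal (thetaPilotIdeal X ρ i) := by
  rw [frakDivisor_thetaPilotFrakModel X τ hτ ρ hρ, ofIdeal_thetaPilotIdeal X τ hτ ρ hρ]

include hτ hρ in
/-- **[IUTchIII] Prop. 3.9 (iii) for the Θ-pilot object, ideal form**: the global log-volume of the `j`-th
component of the Θ-pilot object is `−log N(𝔮̲^{j²})`. [claim: Mochizuki2012, status: disputed] -/
theorem globalLogVolume_thetaPilotFrakModel_eq_neg_log_absNorm (i : Fin X.lstar) :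
    globalLogVolume (divisorLogVolume F) (frakRegion (thetaPilotFrakModel X ρ i)) =
      -Real.log (Ideal.absNorm (thetaPilotIdeal X ρ i)) := by
  rw [globalLogVolume_thetaPilotFrakModel X τ hτ ρ hρ, log_absNorm_thetaPilotIdeal X τ hτ ρ hρ]

end Ideals

/-! ### The Θ-pilot object lies on the weighted diagonal `(j²)` of `Π_j (†𝓕⊛_𝔪𝔬𝔡)_j` -/

section WeightedDiagonal

variable {F : Type} [Field F] [NumberField F] (X : PilotData F)

omit [NumberField F] in
/-- Part A's embedding is compatible with multiples: `ofFinDivisorFrak (n·D) = (ofFinDivisorFrak D)^{⊗n}`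
(abc-iut-L6-t6's tensor-power `ℕ`-action on `𝓕⊛_𝔪𝔬𝔡`-objects). [claim: Mochizuki2012, status: disputed] -/
theorem ofFinDivisorFrak_nsmul [NumberField F] (n : ℕ) (D : FinDivisor F) :
    ofFinDivisorFrak (n • D) = n • ofFinDivisorFrak D :=
  FrakObj.ext_cls <| funext fun p => by
    rcases p with w | v
    · change (n • D) w = (n : ℤ) • D w
      rw [Finsupp.smul_apply, zsmul_eq_mul, nsmul_eq_mul, Int.cast_natCast]
    · change (0 : ℝ) = (n : ℤ) • (0 : ℝ)
      rw [smul_zero]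

/-- **The Θ-pilot object lies on the WEIGHTED DIAGONAL** of `Π_{j∈𝔽_l^⋇} (†𝓕⊛_𝔪𝔬𝔡)_j`: its `j`-th component is the
`j²`-th tensor power of the (embedded) `q`-pilot divisor `P_q` — i.e. it lies in the image of the weight-`(j²)`
embedding `†𝒞^⊩_gau ↪ Π_j †𝒞^⊩_{mod,j}` of [IUTchII] Cor. 4.6 (v) / 4.10 (ii) transported to `†𝒞^⊩_LGP ↪ Π_j (†𝓕⊛ℝ_MOD)_j`
(Prop. 3.7 (iii)(v); cf. abc-iut-w4-d013's `thtToLGP_apply`), by abc-iut-c312-3's `P_{Θ,j} = j²·P_q`.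
[claim: Mochizuki2012, status: disputed] -/
theorem ofLgpDivisor_thetaPilot_eq_nsmul_qPilot (i : Fin X.lstar) :
    ofLgpDivisor X.thetaPilot i = (((i : ℕ) + 1) ^ 2) • ofFinDivisorFrak X.qPilot := by
  change ofFinDivisorFrak (X.thetaPilot i) = _
  rw [PilotData.thetaPilot_eq_smul, ← ofFinDivisorFrak_nsmul]
  congr 1
  rw [← Nat.cast_smul_eq_nsmul ℝ]
  push_cast
  rfl

end WeightedDiagonal

/-! ### §5 Root-independence of the Θ-pilot ideals; the implicit constraint `2l ∣ ord_v(q_v)`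

The binders `ρ`/`hρ` of §4 posit a `2l`-th root `ρ_v` of the Tate parameter `q_v` INSIDE `F_v`
(`v ∈ 𝕍^bad`).  Three proof-only consequences (kernel probes (P1)–(P3) of the w5-d181 audit of this
file, 2026-08-26, adapted): (P1) such a root forces `2l ∣ ord_v(q_v)` — so the §4 identities are
inhabited at `K`-level pilot data (where `q̲_v ∈ 𝒪_{K_v̲}` and `2l ∣ ord(q_v)` is automatic, cf.
[IUTchI] Ex. 3.2 (iv), Def. 3.1 (b)(c)), not at arbitrary pilot data over `F_mod`; (P2) the Θ-pilot
ideal does not depend on the chosen root (print: `q̲_v` is determined up to a `2l`-th root of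
unity); (P3) closed form of the exponents in terms of `X` alone. -/

section RootIndependence

variable {F : Type} [Field F] [NumberField F] (X : PilotData F)
variable (τ : ∀ v ∈ X.S, (v.adicCompletion F)ˣ)
  (hτ : ∀ v (hv : v ∈ X.S), ‖(τ v hv : v.adicCompletion F)‖ < 1 ∧
    tateJ (τ v hv : v.adicCompletion F) = (X.jE : v.adicCompletion F))
  (ρ : ∀ v ∈ X.S, (v.adicCompletion F)ˣ) (hρ : ∀ v (hv : v ∈ X.S), ρ v hv ^ (2 * X.l) = τ v hv)
  (ρ' : ∀ v ∈ X.S, (v.adicCompletion F)ˣ) (hρ' : ∀ v (hv : v ∈ X.S), ρ' v hv ^ (2 * X.l) = τ v hv)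

include hτ hρ in
/-- (P1) **Implicit constraint of the root model**: a `2l`-th root `ρ_v ∈ F_v` of the Tate parameter
forces `2l ∣ ord_v(q_v)` at every `v ∈ 𝕍^bad` (automatic for print's `q̲_v ∈ 𝒪_{K_v̲}`, [IUTchI]
Ex. 3.2 (iv); NOT automatic over `F_mod`). [claim: Mochizuki2012, status: disputed] -/
theorem twoL_dvd_ordq_of_root (v : HeightOneSpectrum (𝓞 F)) (hv : v ∈ X.S) :
    ((2 * X.l : ℕ) : ℤ) ∣ X.ordq v :=
  ⟨CompletionModel.ordv F v (ρ v hv), (ordv_root X τ hτ ρ hρ v hv).symm⟩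

include hτ hρ hρ' in
/-- (P2) Two `2l`-th roots of the Tate parameter at `v` have the same valuation `ord_v(q_v)/2l`.
[claim: Mochizuki2012, status: disputed] -/
theorem ordv_root_eq_of_roots (v : HeightOneSpectrum (𝓞 F)) (hv : v ∈ X.S) :
    CompletionModel.ordv F v (ρ v hv) = CompletionModel.ordv F v (ρ' v hv) := by
  have h1 := ordv_root X τ hτ ρ hρ v hv
  have h2 := ordv_root X τ hτ ρ' hρ' v hv
  have h2l : ((2 * X.l : ℕ) : ℤ) ≠ 0 := by exact_mod_cast (twoL_pos X).ne'
  exact mul_left_cancel₀ h2l (h1.trans h2.symm)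

include hτ hρ hρ' in
/-- (P2) **Root-independence of the Θ-pilot ideal** `𝔮̲^{j²}`: it does not depend on the choice of the
`2l`-th root `ρ` of the Tate parameter (print: `q̲_v` is determined up to a `2l`-th root of unity,
[IUTchI] Ex. 3.2 (iv); the ideal only sees `ord_v`). [claim: Mochizuki2012, status: disputed] -/
theorem thetaPilotIdeal_eq_of_roots (i : Fin X.lstar) :
    thetaPilotIdeal X ρ i = thetaPilotIdeal X ρ' i := by
  unfold thetaPilotIdeal
  congr 1
  funext v hv
  rw [ordv_root_eq_of_roots X τ hτ ρ hρ ρ' hρ' v hv]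

include hτ hρ in
/-- (P3) **Closed form**: `𝔮̲^{j²} = Π_{v ∈ 𝕍^bad} 𝔭_v^{j²·(ord_v(q_v)/2l)}` — the exponents are a
function of the pilot data `X` alone. [claim: Mochizuki2012, status: disputed] -/
theorem thetaPilotIdeal_eq_idealOfBadExponents_ordq (i : Fin X.lstar) :
    thetaPilotIdeal X ρ i =
      idealOfBadExponents X (fun v _ => labelNat i ^ 2 * (X.ordq v / ((2 * X.l : ℕ) : ℤ)).toNat) := by
  unfold thetaPilotIdeal
  congr 1
  funext v hv
  have h := ordv_root X τ hτ ρ hρ v hv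
  have h2l : ((2 * X.l : ℕ) : ℤ) ≠ 0 := by exact_mod_cast (twoL_pos X).ne'
  congr 2
  rw [← h, Int.mul_ediv_cancel_left _ h2l]

end RootIndependence

end Literature.IUT.LogThetaLattice
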